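import Summits.ValiantsHypothesis.ValiantsHypothesis.Theorems.KPlusLogSqLawTropicalBIntervalOpt

/-!
# Route «KPlusLogSqLaw», crux `TropicalB` (stmt-ValiantsHypothesis-19771) — the single-cycle carry law, part 1:
# value counts on a column set and the LEX FORM of the exchange principle (toolkit)

HONEST FRAMING.  Helper file toward the registered stub `stub_tropThin` (⟺ `TropicalB`, open) of
`Cruxes/TropicalB/Lines/birth.lean` (crux `Summit.ValiantsHypothesis.ValiantsHypothesis.Theses.KPlusLogSqLaw.TropicalB`, item
`stmt-ValiantsHypothesis-19771`, route `KPlusLogSqLaw`; cell `pub-symmetroid`, seat val-sym-trop-p1 g3, 2026-08-26).  A STRUCTURE LAW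
in the lex sector (exponent values super-increasing by the size) that every pair of dominant terms obeys; it proves NO part of the
stub and asserts nothing about `TropicalB` in its window, `WeakLifting`, `KPlusLogSqLaw`, `MatrixDescartes` (stmt-18050) or VP ≠ VNP.

THIS FILE (part 1 of 2) proves the counting toolkit (`cnt`, `nsl`, `lex_top`) and the exchange principle in lex form
(`lex_top_of_dominant`); part 2 (`…TropicalBCarryCycle`) proves the three laws below from it.

THE LAW.  Let `p` be the unique optimum at `θa` and `q` at `θb > θa` of one design `(d, v, ε)`, `d` super-increasing by the size
(`d l < d l' → m·d l < d l'`).  Count columns by exponent VALUE: `cnt d J r D = #{i ∈ J : d (r i) = D}`.  Call a column set `W`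
INVARIANT if `σ_p(W) = σ_q(W)` (a union of orbits of `σ_p⁻¹ σ_q`).  Suppose the profiles of `p` and `q` agree at every value above
`h` («leading value `h`»).
* `cnt_eq_above` — no invariant part changes a count above `h` (odometer locality, re-derived from the exchange principle
  `IntervalOpt.sl_lt_of_inOpt`);
* `not_both_lead` — if `q` has exactly ONE more column of value `h` than `p`, then of any invariant `W` and its complement at
  most one changes its count at `h` (the leading orbit is unique);
* `carry_dichotomy` — if moreover every column of `q` of value `< h` sits at the floor value `d₀ = min d` (a FULL CARRY into
  `h`: one unit gained at `h`, everything below reset; this includes every unit step of the lowest digit, `h = d₁`), then for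
  every invariant `W`: `p` and `q` agree (same row AND same class) on all of `W`, or on all of `Wᶜ`.  Corollaries: the changed
  columns lie in ONE orbit of `σ_p⁻¹σ_q` (`carry_single_orbit`), every other orbit is pointwise frozen; every column of `p`
  carrying a middle value (`d₀ < · < h`) changes (`middle_changes`), so the carry cycle threads ALL lower-digit columns of `p`
  and the column that gains `h`; an invariant block that misses one changed column is completely frozen (`carry_block_frozen`) —
  during a full carry no sub-register, parked gadget or second coupling can do anything on the side.
Design reading (cell memo CARRY-CYCLE.md of this seat): this is the exact obstruction that kills «D digits as multi-hole registers
with private pairwise coupling blocks» (a reset would close inside the digit's own columns), and the reason the tree's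
`CoupledRegister` works (two one-hole registers: the single coupling entry closes the two hole paths into one cycle).
PROOF.  Exchange principle on `W` and on `Wᶜ` (both invariant) gives `sl_W(p) < sl_W(q)`; with super-increasing values the top
value where the `W`-counts differ favours `q` (`lex_top`); a top above `h` on either side contradicts «equal above `h`» (take the
larger top), two tops at `h` contradict «+1 at `h`», a top below `h` is a value of `q` below `h`, i.e. the floor, where a strict
excess with equal counts above and nothing below contradicts `|W| = |W|`.
[folklore] parametric-assignment exchange arguments; the statements are the cell's (no citation exists).
-/

set_option linter.dupNamespace false
set_option autoImplicit false

namespace Summit.ValiantsHypothesis.ValiantsHypothesis.Theorems.KPlusLogSqLaw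

open Summit.ValiantsHypothesis.ValiantsHypothesis.Theorems.MatrixDescartes.Negative
open Finset

namespace CarryCycle

variable {m K : ℕ}

/-! ## 1. Value counts and the natural-number slope of a class map on a column set -/

/-- number of columns of `J` whose class under `r` has exponent VALUE `D`. [definition of the cell] -/
def cnt (d : Fin K → ℕ) (J : Finset (Fin m)) (r : Fin m → Fin K) (D : ℕ) : ℕ :=
  (J.filter fun i => d (r i) = D).card

/-- natural-number slope of the class map `r` on `J`. [definition of the cell] -/
def nsl (d : Fin K → ℕ) (J : Finset (Fin m)) (r : Fin m → Fin K) : ℕ := ∑ i ∈ J, d (r i)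

/-- the tree's integer slope `IntervalOpt.sl` is the cast of `nsl`. [folklore] -/
theorem sl_eq_nsl (d : Fin K → ℕ) (J : Finset (Fin m)) (p : Equiv.Perm (Fin m) × (Fin m → Fin K)) :
    IntervalOpt.sl d J p = (nsl d J p.2 : ℤ) := by
  unfold IntervalOpt.sl nsl
  push_cast
  rfl

/-- a value that is not an exponent value is counted zero. [folklore] -/
theorem cnt_eq_zero_of_not_mem (d : Fin K → ℕ) (J : Finset (Fin m)) (r : Fin m → Fin K) {D : ℕ}
    (hD : D ∉ univ.image d) : cnt d J r D = 0 := by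
  unfold cnt
  rw [card_eq_zero, filter_eq_empty_iff]
  intro i _ h
  exact hD (mem_image.2 ⟨r i, mem_univ _, h⟩)

/-- counts on `W` and `Wᶜ` add up to the global count. [folklore] -/
theorem cnt_add_compl (d : Fin K → ℕ) (W : Finset (Fin m)) (r : Fin m → Fin K) (D : ℕ) :
    cnt d W r D + cnt d Wᶜ r D = cnt d univ r D := by
  unfold cnt
  rw [← card_union_of_disjoint (disjoint_filter_filter (disjoint_compl_right (a := W)))]
  congr 1
  ext i
  simp only [mem_union, mem_filter, mem_compl, mem_univ, true_and]
  tauto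

/-- the slope is the value-weighted sum of the counts. [folklore] -/
theorem nsl_eq_sum_cnt (d : Fin K → ℕ) (J : Finset (Fin m)) (r : Fin m → Fin K) :
    nsl d J r = ∑ D ∈ univ.image d, D * cnt d J r D := by
  unfold nsl cnt
  rw [← sum_fiberwise_of_maps_to (s := J) (t := univ.image d) (g := fun i => d (r i))
    (fun i _ => mem_image_of_mem d (mem_univ _))]
  refine sum_congr rfl fun D _ => ?_
  rw [sum_const_nat (m := D) (fun i hi => (mem_filter.1 hi).2), mul_comm]

/-- equal counts give equal slopes. [folklore] -/
theorem nsl_eq_of_cnt_eq (d : Fin K → ℕ) (J : Finset (Fin m)) {r₁ r₂ : Fin m → Fin K}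
    (h : ∀ D, cnt d J r₁ D = cnt d J r₂ D) : nsl d J r₁ = nsl d J r₂ := by
  rw [nsl_eq_sum_cnt, nsl_eq_sum_cnt]
  exact sum_congr rfl fun D _ => by rw [h D]

/-- the cardinality of `J` is the sum of its counts. [folklore] -/
theorem card_eq_sum_cnt (d : Fin K → ℕ) (J : Finset (Fin m)) (r : Fin m → Fin K) :
    J.card = ∑ D ∈ univ.image d, cnt d J r D := by
  unfold cnt
  exact card_eq_sum_card_fiberwise fun i _ => mem_image_of_mem d (mem_univ _)

/-! ## 2. The lex comparison on a column set: the top differing value favours the larger slope -/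

/-- split of the slope at a threshold value `T`: the part above `T`, `T` times the count at `T`, and the part below `T`.
[folklore] -/
theorem nsl_split (d : Fin K → ℕ) (J : Finset (Fin m)) (r : Fin m → Fin K) (T : ℕ) :
    nsl d J r = (∑ i ∈ J.filter (fun i => T < d (r i)), d (r i)) + T * cnt d J r T +
      ∑ i ∈ J.filter (fun i => d (r i) < T), d (r i) := by
  unfold nsl cnt
  rw [← sum_filter_add_sum_filter_not J (fun i => T < d (r i))]
  rw [add_assoc]
  congr 1
  rw [← sum_filter_add_sum_filter_not (J.filter fun i => ¬ T < d (r i)) (fun i => d (r i) = T)]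
  congr 1
  · rw [sum_const_nat (m := T) (fun i hi => (mem_filter.1 hi).2), mul_comm]
    congr 1
    congr 1
    ext i
    simp only [mem_filter, not_lt]
    constructor
    · rintro ⟨⟨hi, _⟩, h2⟩; exact ⟨hi, h2⟩
    · rintro ⟨hi, h2⟩; exact ⟨⟨hi, h2.le⟩, h2⟩
  · apply sum_congr
    · ext i
      simp only [mem_filter, not_lt]
      constructor
      · rintro ⟨⟨hi, h1⟩, h2⟩; exact ⟨hi, lt_of_le_of_ne h1 h2⟩
      · rintro ⟨hi, h2⟩; exact ⟨⟨hi, h2.le⟩, h2.ne⟩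
    · intro i _; rfl

/-- the part of the slope above `T` is determined by the counts above `T`. [folklore] -/
theorem above_eq_of_cnt_eq (d : Fin K → ℕ) (J : Finset (Fin m)) {r₁ r₂ : Fin m → Fin K} {T : ℕ}
    (h : ∀ D, T < D → cnt d J r₁ D = cnt d J r₂ D) :
    ∑ i ∈ J.filter (fun i => T < d (r₁ i)), d (r₁ i) = ∑ i ∈ J.filter (fun i => T < d (r₂ i)), d (r₂ i) := by
  have key : ∀ r : Fin m → Fin K, ∑ i ∈ J.filter (fun i => T < d (r i)), d (r i) =
      ∑ D ∈ (univ.image d).filter (fun D => T < D), D * cnt d J r D := by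
    intro r
    rw [← sum_fiberwise_of_maps_to (s := J.filter fun i => T < d (r i)) (t := (univ.image d).filter fun D => T < D)
      (g := fun i => d (r i)) (fun i hi => mem_filter.2 ⟨mem_image_of_mem d (mem_univ _), (mem_filter.1 hi).2⟩)]
    refine sum_congr rfl fun D hD => ?_
    have hTD : T < D := (mem_filter.1 hD).2
    rw [sum_const_nat (m := D) (fun i hi => (mem_filter.1 hi).2), mul_comm]
    unfold cnt
    congr 2
    ext i
    simp only [mem_filter]
    constructor
    · rintro ⟨⟨hi, _⟩, h2⟩; exact ⟨hi, h2⟩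
    · rintro ⟨hi, h2⟩; exact ⟨⟨hi, h2 ▸ hTD⟩, h2⟩
  rw [key, key]
  exact sum_congr rfl fun D hD => by rw [h D (mem_filter.1 hD).2]

/-- under super-increasing values, the part of the slope strictly below a value `T = d l₀` is at most `T`
(indeed `< T` unless it is empty). [folklore] -/
theorem below_le (d : Fin K → ℕ) (hlex : ∀ l l', d l < d l' → m * d l < d l') (J : Finset (Fin m))
    (r : Fin m → Fin K) (l₀ : Fin K) :
    ∑ i ∈ J.filter (fun i => d (r i) < d l₀), d (r i) ≤ d l₀ := by
  set S := J.filter (fun i => d (r i) < d l₀) with hS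
  rcases S.eq_empty_or_nonempty with h0 | hne
  · rw [h0, sum_empty]; exact Nat.zero_le _
  · obtain ⟨i₀, hi₀⟩ := hne
    have hm : 0 < m := Fin.pos i₀
    have h1 : m * ∑ i ∈ S, d (r i) ≤ S.card * (d l₀ - 1) := by
      rw [mul_sum]
      calc ∑ i ∈ S, m * d (r i) ≤ ∑ _i ∈ S, (d l₀ - 1) :=
            sum_le_sum fun i hi => by
              have := hlex (r i) l₀ (mem_filter.1 hi).2
              omega
        _ = S.card * (d l₀ - 1) := by rw [sum_const, smul_eq_mul]
    have h2 : S.card ≤ m := (card_le_univ S).trans (by rw [Fintype.card_fin])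
    have h3 : m * ∑ i ∈ S, d (r i) ≤ m * (d l₀ - 1) := h1.trans (Nat.mul_le_mul_right _ h2)
    have h4 : ∑ i ∈ S, d (r i) ≤ d l₀ - 1 := Nat.le_of_mul_le_mul_left h3 hm
    omega

/-- existence of a TOP differing value. [folklore] -/
theorem exists_top (d : Fin K → ℕ) (J : Finset (Fin m)) {r₁ r₂ : Fin m → Fin K}
    (h : ∃ D, cnt d J r₁ D ≠ cnt d J r₂ D) :
    ∃ l₀ : Fin K, cnt d J r₁ (d l₀) ≠ cnt d J r₂ (d l₀) ∧ ∀ D, d l₀ < D → cnt d J r₁ D = cnt d J r₂ D := by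
  classical
  set S := (univ.image d).filter (fun D => cnt d J r₁ D ≠ cnt d J r₂ D) with hS
  have hSne : S.Nonempty := by
    obtain ⟨D, hD⟩ := h
    have hDim : D ∈ univ.image d := by
      by_contra hc
      exact hD (by rw [cnt_eq_zero_of_not_mem d J r₁ hc, cnt_eq_zero_of_not_mem d J r₂ hc])
    exact ⟨D, mem_filter.2 ⟨hDim, hD⟩⟩
  set T := S.max' hSne with hT
  have hTS : T ∈ S := max'_mem S hSne
  obtain ⟨l₀, _, hl₀⟩ := mem_image.1 (mem_filter.1 hTS).1
  refine ⟨l₀, ?_, fun D hD => ?_⟩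
  · rw [hl₀]; exact (mem_filter.1 hTS).2
  · by_contra hc
    have hDim : D ∈ univ.image d := by
      by_contra hc'
      exact hc (by rw [cnt_eq_zero_of_not_mem d J r₁ hc', cnt_eq_zero_of_not_mem d J r₂ hc'])
    have hDS : D ∈ S := mem_filter.2 ⟨hDim, hc⟩
    have := le_max' S D hDS
    rw [hl₀] at hD
    exact absurd hD (not_lt.2 (hT ▸ this))

/-- if the counts agree above `T = d l₀` and `r₁` has MORE columns of value `T`, then `r₁` has the larger (or equal) slope.
[folklore] -/
theorem nsl_ge_of_top (d : Fin K → ℕ) (hlex : ∀ l l', d l < d l' → m * d l < d l') (J : Finset (Fin m))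
    {r₁ r₂ : Fin m → Fin K} (l₀ : Fin K) (habove : ∀ D, d l₀ < D → cnt d J r₁ D = cnt d J r₂ D)
    (hT : cnt d J r₂ (d l₀) < cnt d J r₁ (d l₀)) : nsl d J r₂ ≤ nsl d J r₁ := by
  rw [nsl_split d J r₁ (d l₀), nsl_split d J r₂ (d l₀), above_eq_of_cnt_eq d J habove]
  have hb := below_le d hlex J r₂ l₀
  have h1 : d l₀ * cnt d J r₂ (d l₀) + d l₀ ≤ d l₀ * cnt d J r₁ (d l₀) := by
    have : cnt d J r₂ (d l₀) + 1 ≤ cnt d J r₁ (d l₀) := hT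
    nlinarith
  have h0 : 0 ≤ ∑ i ∈ J.filter (fun i => d (r₁ i) < d l₀), d (r₁ i) := Nat.zero_le _
  omega

/-- **LEX COMPARISON ON A COLUMN SET.**  Under super-increasing values, if `r₁` has strictly smaller slope than `r₂` on `J`, then
there is a top value `T = d l₀` at which the `J`-counts differ, `r₂` has MORE columns of value `T`, and all counts above `T` agree.
[folklore] -/
theorem lex_top (d : Fin K → ℕ) (hlex : ∀ l l', d l < d l' → m * d l < d l') (J : Finset (Fin m))
    {r₁ r₂ : Fin m → Fin K} (hlt : nsl d J r₁ < nsl d J r₂) :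
    ∃ l₀ : Fin K, cnt d J r₁ (d l₀) < cnt d J r₂ (d l₀) ∧ ∀ D, d l₀ < D → cnt d J r₁ D = cnt d J r₂ D := by
  have hne : ∃ D, cnt d J r₁ D ≠ cnt d J r₂ D := by
    by_contra hc
    push Not at hc
    exact absurd (nsl_eq_of_cnt_eq d J hc) hlt.ne
  obtain ⟨l₀, hneq, habove⟩ := exists_top d J hne
  refine ⟨l₀, ?_, habove⟩
  rcases lt_or_gt_of_ne hneq with h | h
  · exact h
  · exact absurd (nsl_ge_of_top d hlex J l₀ habove h) (not_le.2 hlt)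

/-! ## 3. Two dominant terms: the exchange principle on an invariant column set, in count language -/

variable {d : Fin K → ℕ} {v ε : Fin m → Fin m → Fin K → ℤ}

/-- the complement of an invariant column set is invariant. [folklore] -/
theorem image_compl_eq {p q : Equiv.Perm (Fin m) × (Fin m → Fin K)} {W : Finset (Fin m)}
    (hW : W.image p.1 = W.image q.1) : Wᶜ.image p.1 = Wᶜ.image q.1 := by
  have key : ∀ σ : Equiv.Perm (Fin m), Wᶜ.image σ = (W.image σ)ᶜ := by
    intro σ
    ext a
    simp only [mem_image, mem_compl]
    constructor
    · rintro ⟨i, hi, rfl⟩ ⟨j, hj, hij⟩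
      exact hi (σ.injective hij ▸ hj)
    · intro h
      refine ⟨σ.symm a, fun hm => h ⟨σ.symm a, hm, σ.apply_symm_apply a⟩, σ.apply_symm_apply a⟩
  rw [key, key, hW]

/-- **EXCHANGE PRINCIPLE IN LEX FORM.**  `p` dominant at `θa`, `q` dominant at `θb > θa`, values super-increasing, `W` invariant
and `p ≠ q` somewhere on `W`: the top value where the `W`-counts differ exists and favours `q`. [folklore] -/
theorem lex_top_of_dominant (hlex : ∀ l l', d l < d l' → m * d l < d l') {θa θb : ℤ} (hab : θa < θb)
    {p q : Equiv.Perm (Fin m) × (Fin m → Fin K)} (hp : IsDominant d v ε θa p) (hq : IsDominant d v ε θb q)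
    {W : Finset (Fin m)} (hW : W.image p.1 = W.image q.1) (hdiff : ∃ i ∈ W, p.1 i ≠ q.1 i ∨ p.2 i ≠ q.2 i) :
    ∃ l₀ : Fin K, cnt d W p.2 (d l₀) < cnt d W q.2 (d l₀) ∧ ∀ D, d l₀ < D → cnt d W p.2 D = cnt d W q.2 D := by
  have hne : IntervalOpt.restr W p ≠ IntervalOpt.restr W q := by
    intro h
    rw [IntervalOpt.restr_eq_iff] at h
    obtain ⟨i, hi, hd⟩ := hdiff
    obtain ⟨h1, h2⟩ := h i hi
    rcases hd with hd | hd
    · exact hd h1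
    · exact hd h2
  have hsl := IntervalOpt.sl_lt_of_inOpt
    (IntervalOpt.inOpt_mono (subset_univ W) (IntervalOpt.inOpt_univ_of_isDominant hp))
    (IntervalOpt.inOpt_mono (subset_univ W) (IntervalOpt.inOpt_univ_of_isDominant hq)) hW hab hne
  rw [sl_eq_nsl, sl_eq_nsl] at hsl
  exact lex_top d hlex W (by exact_mod_cast hsl)

/-- counts that differ somewhere force a differing column. [folklore] -/
theorem exists_diff_of_cnt_ne {p q : Equiv.Perm (Fin m) × (Fin m → Fin K)} {W : Finset (Fin m)} {D : ℕ}
    (h : cnt d W p.2 D ≠ cnt d W q.2 D) : ∃ i ∈ W, p.1 i ≠ q.1 i ∨ p.2 i ≠ q.2 i := by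
  by_contra hc
  push Not at hc
  apply h
  unfold cnt
  congr 1
  ext i
  simp only [mem_filter]
  constructor
  · rintro ⟨hi, h2⟩; exact ⟨hi, (hc i hi).2 ▸ h2⟩
  · rintro ⟨hi, h2⟩; exact ⟨hi, (hc i hi).2.symm ▸ h2⟩

end CarryCycle

end Summit.ValiantsHypothesis.ValiantsHypothesis.Theorems.KPlusLogSqLaw
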